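import Summits.AtomisticToContinuum.HydrodynamicLimit.Theorems.CollisionIsometryCLTAdaptedWeightCLTBHDVTransferChaos

/-!
# DV transfer for the line `block-h-dissipation-closure` (crux `AdaptedWeightCLT`, stmt-AtomisticToContinuum-14868),
# file 8: two-sided bounds on the regularised cell law `cellLaw` and on `log cellLaw`

Support file (`--supports stmt-AtomisticToContinuum-14868`, anchor `bhDVTransfer_cellLaw_anchor`) of the line lead
`prover-line-stmt-AtomisticToContinuum-14868-c4-0`, written for the registered stub `stub_dvTransfer` (S2) but of
use to every stub of the line (S1's Bregman remainders, S3, S5): the elementary deterministic bounds on the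
regularised cell law `f̂_x = (1 − δ) f̃_x + δ M_{1, θ̄_x + h², ū_x}` of a configuration `w` at `x`, for a nonnegative
kernel family `ψ`, `h > 0`, `0 ≤ δ ≤ 1`:

* `cW_nonneg`, `cT_nonneg`, `kde_nonneg`, `gauss_le_gaussMax` (`G_h ≤ G_h(0) = (2πh²)^{-3/2}`),
  `kde_le_gaussMax`;
* the FLOOR and the CEILING: `δ M_{1, θ̄+h², ū}(v) ≤ f̂(v) ≤ (2πh²)^{-3/2}` (`floor_le_cellLaw`, `cellLaw_le_gaussMax`),
  `cellLaw_pos` (`δ > 0`), `continuous_cellLaw`;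
* LOG BOUNDS: `log f̂ ≤ log G_h(0)`, `log δ + log (2π(θ̄+h²))^{-3/2} − ‖v − ū‖²/(2(θ̄+h²)) ≤ log f̂(v)`, hence the
  quadratic envelope `|log f̂(v)| ≤ L + ‖v − ū‖²/(2h²)` (`abs_log_cellLaw_le`) with
  `L = |log G_h(0)| + |log δ| + |log (2π(θ̄+h²))^{-3/2}|` — the envelope that makes `ΔΛ` integrable against every
  Gaussian mixture on `Quad`, and `e^{ΔΛ/2}` integrable against the chaos reference (`1/(4(θ̄+h²)) < 1/(2h²)`).

No definitions; `(2πθ)^{-3/2}` is written `(2πθ)^{-(finrank ℝ V3)/2}` as in `localMaxwellian`.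
-/

namespace Summit.AtomisticToContinuum.HydrodynamicLimit.Theorems.BlockHDissipation

open scoped BigOperators Topology Classical MeasureTheory ENNReal InnerProductSpace
open Filter Set MeasureTheory Real
open Literature.Analysis.FluidPDE
open Summit.AtomisticToContinuum.HydrodynamicLimit.Theorems.ContactSourceDuhamel (T3 V3 Cfg Vel Flow Flows)
open Literature.MathematicalPhysics.KineticTheory (collide hardSphereKernel sphereMeasure)

noncomputable section

namespace DVTransfer

variable {ψ : ℕ → T3 → ℝ} {N : ℕ}

/-! ## Weights, cell temperature, KDE -/

/-- The total cell weight is nonnegative. -/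
theorem cW_nonneg (hψ : ∀ N y, 0 ≤ ψ N y) (w : Cfg N) (x : T3) : 0 ≤ cW N ψ w x :=
  Finset.sum_nonneg fun i _ => cw_nonneg hψ N w x i

/-- The cell temperature is nonnegative. -/
theorem cT_nonneg (hψ : ∀ N y, 0 ≤ ψ N y) (w : Cfg N) (x : T3) : 0 ≤ cT N ψ w x := by
  unfold cT
  exact mul_nonneg (inv_nonneg.2 (cW_nonneg hψ w x))
    (Finset.sum_nonneg fun i _ => mul_nonneg (cw_nonneg hψ N w x i) (by positivity))

/-- `G_h ≥ 0` (any `h`). -/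
theorem gauss_nonneg (h : ℝ) (u v : V3) : 0 ≤ gauss h u v :=
  Literature.MathematicalPhysics.KineticTheory.localMaxwellian_nonneg zero_le_one (sq_nonneg h) u v

/-- The Gaussian mollifier is maximal at its centre: `G_h(v − u) ≤ G_h(0)`. -/
theorem gauss_le_gaussMax (h : ℝ) (u v : V3) : gauss h u v ≤ gauss h 0 0 := by
  unfold gauss localMaxwellian
  refine mul_le_mul_of_nonneg_left ?_ (mul_nonneg zero_le_one (rpow_nonneg (by positivity) _))
  rw [sub_zero, norm_zero]
  refine exp_le_exp.2 ?_
  have : (0 : ℝ) ^ 2 = 0 := by norm_num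
  rw [this, neg_zero, zero_div]
  exact div_nonpos_of_nonpos_of_nonneg (neg_nonpos.2 (sq_nonneg _)) (by positivity)

/-- `G_h(0) = (2πh²)^{-3/2} > 0`. -/
theorem gaussMax_eq (h : ℝ) : gauss h (0 : V3) 0 = (2 * π * h ^ 2) ^ (-(Module.finrank ℝ V3 : ℝ) / 2) := by
  simp [gauss, localMaxwellian]

/-- The KDE is nonnegative. -/
theorem kde_nonneg (hψ : ∀ N y, 0 ≤ ψ N y) (h : ℝ) (w : Cfg N) (x : T3) (v : V3) : 0 ≤ kde N ψ h w x v := by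
  unfold kde
  exact mul_nonneg (inv_nonneg.2 (cW_nonneg hψ w x))
    (Finset.sum_nonneg fun i _ => mul_nonneg (cw_nonneg hψ N w x i) (gauss_nonneg h _ _))

/-- The KDE is bounded by the peak of the mollifier: `f̃(v) ≤ G_h(0)` (convex combination; `0` on an empty cell). -/
theorem kde_le_gaussMax (hψ : ∀ N y, 0 ≤ ψ N y) (h : ℝ) (w : Cfg N) (x : T3) (v : V3) :
    kde N ψ h w x v ≤ gauss h 0 0 := by
  unfold kde
  by_cases hW : cW N ψ w x = 0
  · rw [hW, inv_zero, zero_mul]; exact gauss_nonneg h 0 0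
  · have hWpos : 0 < cW N ψ w x := lt_of_le_of_ne (cW_nonneg hψ w x) (Ne.symm hW)
    have hle : ∑ i, cw N ψ w x i * gauss h (w i).2 v ≤ ∑ i, cw N ψ w x i * gauss h 0 0 :=
      Finset.sum_le_sum fun i _ => mul_le_mul_of_nonneg_left (gauss_le_gaussMax h _ _) (cw_nonneg hψ N w x i)
    rw [← Finset.sum_mul] at hle
    calc (cW N ψ w x)⁻¹ * ∑ i, cw N ψ w x i * gauss h (w i).2 v
        ≤ (cW N ψ w x)⁻¹ * (cW N ψ w x * gauss h 0 0) :=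
          mul_le_mul_of_nonneg_left hle (inv_nonneg.2 hWpos.le)
      _ = gauss h 0 0 := by rw [← mul_assoc, inv_mul_cancel₀ hW, one_mul]

/-! ## The floor Maxwellian -/

/-- The co-moving co-thermal floor Maxwellian is bounded by its prefactor:
`M_{1, θ̄+h², ū}(v) ≤ (2π(θ̄+h²))^{-3/2}`. -/
theorem floorMaxwellian_le_prefactor (hψ : ∀ N y, 0 ≤ ψ N y) (h : ℝ) (w : Cfg N) (x : T3) (v : V3) :
    localMaxwellian 1 (cT N ψ w x + h ^ 2) (cU N ψ w x) v ≤
      (2 * π * (cT N ψ w x + h ^ 2)) ^ (-(Module.finrank ℝ V3 : ℝ) / 2) := by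
  have hτ : 0 ≤ cT N ψ w x + h ^ 2 := add_nonneg (cT_nonneg hψ w x) (sq_nonneg h)
  unfold localMaxwellian
  rw [one_mul]
  refine mul_le_of_le_one_right (rpow_nonneg (by positivity) _) (exp_le_one_iff.2 ?_)
  exact div_nonpos_of_nonpos_of_nonneg (neg_nonpos.2 (sq_nonneg _)) (by positivity)

/-- The prefactor of the floor is bounded by the peak of the mollifier: `(2π(θ̄+h²))^{-3/2} ≤ (2πh²)^{-3/2} = G_h(0)`
(`h ≠ 0`; the base grows, the exponent is negative). -/
theorem prefactor_le_gaussMax (hψ : ∀ N y, 0 ≤ ψ N y) {h : ℝ} (hh : h ≠ 0) (w : Cfg N) (x : T3) :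
    (2 * π * (cT N ψ w x + h ^ 2)) ^ (-(Module.finrank ℝ V3 : ℝ) / 2) ≤ gauss h (0 : V3) 0 := by
  rw [gaussMax_eq]
  have hh2 : 0 < h ^ 2 := pow_pos (abs_pos.2 hh) 2 |>.trans_eq (sq_abs h)
  refine Real.rpow_le_rpow_of_nonpos (by positivity) ?_ ?_
  · exact mul_le_mul_of_nonneg_left (le_add_of_nonneg_left (cT_nonneg hψ w x)) (by positivity)
  · exact div_nonpos_of_nonpos_of_nonneg (neg_nonpos.2 (Nat.cast_nonneg _)) zero_le_two

/-- The floor Maxwellian is positive (`h ≠ 0`). -/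
theorem floorMaxwellian_pos (hψ : ∀ N y, 0 ≤ ψ N y) {h : ℝ} (hh : h ≠ 0) (w : Cfg N) (x : T3) (v : V3) :
    0 < localMaxwellian 1 (cT N ψ w x + h ^ 2) (cU N ψ w x) v :=
  Literature.MathematicalPhysics.KineticTheory.localMaxwellian_pos zero_lt_one
    (add_pos_of_nonneg_of_pos (cT_nonneg hψ w x) (pow_pos (abs_pos.2 hh) 2 |>.trans_eq (sq_abs h))) _ _

/-! ## Floor and ceiling of the regularised cell law -/

/-- **The floor**: `δ M_{1, θ̄+h², ū}(v) ≤ f̂(v)` (`δ ≤ 1`). -/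
theorem floor_le_cellLaw (hψ : ∀ N y, 0 ≤ ψ N y) (h : ℝ) {δ : ℝ} (hδ1 : δ ≤ 1) (w : Cfg N) (x : T3) (v : V3) :
    δ * localMaxwellian 1 (cT N ψ w x + h ^ 2) (cU N ψ w x) v ≤ cellLaw N ψ h δ w x v := by
  unfold cellLaw
  have : 0 ≤ (1 - δ) * kde N ψ h w x v := mul_nonneg (by linarith) (kde_nonneg hψ h w x v)
  linarith

/-- **The ceiling**: `f̂(v) ≤ G_h(0) = (2πh²)^{-3/2}` (`h ≠ 0`, `0 ≤ δ ≤ 1`). -/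
theorem cellLaw_le_gaussMax (hψ : ∀ N y, 0 ≤ ψ N y) {h : ℝ} (hh : h ≠ 0) {δ : ℝ} (hδ0 : 0 ≤ δ) (hδ1 : δ ≤ 1)
    (w : Cfg N) (x : T3) (v : V3) : cellLaw N ψ h δ w x v ≤ gauss h 0 0 := by
  unfold cellLaw
  have h1 : kde N ψ h w x v ≤ gauss h 0 0 := kde_le_gaussMax hψ h w x v
  have h2 : localMaxwellian 1 (cT N ψ w x + h ^ 2) (cU N ψ w x) v ≤ gauss h 0 0 :=
    (floorMaxwellian_le_prefactor hψ h w x v).trans (prefactor_le_gaussMax hψ hh w x)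
  nlinarith

/-- The regularised cell law is positive (`h ≠ 0`, `0 < δ ≤ 1`). -/
theorem cellLaw_pos (hψ : ∀ N y, 0 ≤ ψ N y) {h : ℝ} (hh : h ≠ 0) {δ : ℝ} (hδ0 : 0 < δ) (hδ1 : δ ≤ 1)
    (w : Cfg N) (x : T3) (v : V3) : 0 < cellLaw N ψ h δ w x v :=
  lt_of_lt_of_le (mul_pos hδ0 (floorMaxwellian_pos hψ hh w x v)) (floor_le_cellLaw hψ h hδ1 w x v)

/-- The peak of the mollifier is positive (`h ≠ 0`). -/
theorem gaussMax_pos {h : ℝ} (hh : h ≠ 0) : 0 < gauss h (0 : V3) 0 := gauss_pos hh 0 0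

/-- The regularised cell law is continuous in the velocity. -/
theorem continuous_cellLaw (ψ : ℕ → T3 → ℝ) (h δ : ℝ) (w : Cfg N) (x : T3) : Continuous (cellLaw N ψ h δ w x) := by
  have hk : Continuous (kde N ψ h w x) := by
    unfold kde
    exact continuous_const.mul (continuous_finsetSum _ fun i _ => continuous_const.mul (continuous_gauss h _))
  unfold cellLaw
  exact (continuous_const.mul hk).add
    (continuous_const.mul (Literature.MathematicalPhysics.KineticTheory.continuous_localMaxwellian _ _ _))

/-- `log ∘ f̂` is measurable. -/
theorem measurable_log_cellLaw (ψ : ℕ → T3 → ℝ) (h δ : ℝ) (w : Cfg N) (x : T3) :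
    Measurable fun v => Real.log (cellLaw N ψ h δ w x v) :=
  Real.measurable_log.comp (continuous_cellLaw ψ h δ w x).measurable

/-! ## Log bounds -/

/-- Upper log bound: `log f̂(v) ≤ log G_h(0)`. -/
theorem log_cellLaw_le (hψ : ∀ N y, 0 ≤ ψ N y) {h : ℝ} (hh : h ≠ 0) {δ : ℝ} (hδ0 : 0 < δ) (hδ1 : δ ≤ 1)
    (w : Cfg N) (x : T3) (v : V3) : Real.log (cellLaw N ψ h δ w x v) ≤ Real.log (gauss h 0 0) :=
  Real.log_le_log (cellLaw_pos hψ hh hδ0 hδ1 w x v) (cellLaw_le_gaussMax hψ hh hδ0.le hδ1 w x v)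

/-- Lower log bound: `log δ + log (2π(θ̄+h²))^{-3/2} − ‖v − ū‖²/(2(θ̄+h²)) ≤ log f̂(v)`. -/
theorem log_cellLaw_ge (hψ : ∀ N y, 0 ≤ ψ N y) {h : ℝ} (hh : h ≠ 0) {δ : ℝ} (hδ0 : 0 < δ) (hδ1 : δ ≤ 1)
    (w : Cfg N) (x : T3) (v : V3) :
    Real.log δ + Real.log ((2 * π * (cT N ψ w x + h ^ 2)) ^ (-(Module.finrank ℝ V3 : ℝ) / 2)) -
        ‖v - cU N ψ w x‖ ^ 2 / (2 * (cT N ψ w x + h ^ 2)) ≤ Real.log (cellLaw N ψ h δ w x v) := by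
  have hM := floorMaxwellian_pos hψ hh w x v
  have hfl := floor_le_cellLaw hψ h hδ1 w x v
  have hlog : Real.log (δ * localMaxwellian 1 (cT N ψ w x + h ^ 2) (cU N ψ w x) v) ≤
      Real.log (cellLaw N ψ h δ w x v) := Real.log_le_log (mul_pos hδ0 hM) hfl
  have hpref : 0 < (2 * π * (cT N ψ w x + h ^ 2)) ^ (-(Module.finrank ℝ V3 : ℝ) / 2) := by
    have hτ : 0 < cT N ψ w x + h ^ 2 :=
      add_pos_of_nonneg_of_pos (cT_nonneg hψ w x) (pow_pos (abs_pos.2 hh) 2 |>.trans_eq (sq_abs h))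
    positivity
  have e : Real.log (δ * localMaxwellian 1 (cT N ψ w x + h ^ 2) (cU N ψ w x) v) =
      Real.log δ + Real.log ((2 * π * (cT N ψ w x + h ^ 2)) ^ (-(Module.finrank ℝ V3 : ℝ) / 2)) -
        ‖v - cU N ψ w x‖ ^ 2 / (2 * (cT N ψ w x + h ^ 2)) := by
    unfold localMaxwellian
    rw [one_mul, Real.log_mul hδ0.ne' (mul_pos hpref (exp_pos _)).ne', Real.log_mul hpref.ne' (exp_pos _).ne',
      Real.log_exp]
    ring
  linarith

/-- The quadratic term with the cell temperature is dominated by the one with `h²` alone: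
`‖v − ū‖²/(2(θ̄+h²)) ≤ ‖v − ū‖²/(2h²)`. -/
theorem quad_cT_le (hψ : ∀ N y, 0 ≤ ψ N y) {h : ℝ} (hh : h ≠ 0) (w : Cfg N) (x : T3) (v : V3) :
    ‖v - cU N ψ w x‖ ^ 2 / (2 * (cT N ψ w x + h ^ 2)) ≤ ‖v - cU N ψ w x‖ ^ 2 / (2 * h ^ 2) := by
  have hh2 : 0 < h ^ 2 := pow_pos (abs_pos.2 hh) 2 |>.trans_eq (sq_abs h)
  refine div_le_div_of_nonneg_left (sq_nonneg _) (by positivity) ?_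
  linarith [cT_nonneg hψ w x]

/-- **The quadratic envelope of `log f̂`**: `|log f̂(v)| ≤ L + ‖v − ū‖²/(2h²)` with
`L = |log G_h(0)| + |log δ| + |log (2π(θ̄+h²))^{-3/2}|` (`h ≠ 0`, `0 < δ ≤ 1`). -/
theorem abs_log_cellLaw_le (hψ : ∀ N y, 0 ≤ ψ N y) {h : ℝ} (hh : h ≠ 0) {δ : ℝ} (hδ0 : 0 < δ) (hδ1 : δ ≤ 1)
    (w : Cfg N) (x : T3) (v : V3) :
    |Real.log (cellLaw N ψ h δ w x v)| ≤
      (|Real.log (gauss h (0 : V3) 0)| + |Real.log δ| +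
        |Real.log ((2 * π * (cT N ψ w x + h ^ 2)) ^ (-(Module.finrank ℝ V3 : ℝ) / 2))|) +
        ‖v - cU N ψ w x‖ ^ 2 / (2 * h ^ 2) := by
  have hup := log_cellLaw_le hψ hh hδ0 hδ1 w x v
  have hlo := log_cellLaw_ge hψ hh hδ0 hδ1 w x v
  have hq := quad_cT_le hψ hh w x v
  have hq0 : 0 ≤ ‖v - cU N ψ w x‖ ^ 2 / (2 * h ^ 2) := by positivity
  rw [abs_le]
  constructor
  · have h1 := neg_abs_le (Real.log δ)
    have h2 := neg_abs_le (Real.log ((2 * π * (cT N ψ w x + h ^ 2)) ^ (-(Module.finrank ℝ V3 : ℝ) / 2)))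
    have h3 := abs_nonneg (Real.log (gauss h (0 : V3) 0))
    linarith
  · have h1 := le_abs_self (Real.log (gauss h (0 : V3) 0))
    have h2 := abs_nonneg (Real.log δ)
    have h3 := abs_nonneg (Real.log ((2 * π * (cT N ψ w x + h ^ 2)) ^ (-(Module.finrank ℝ V3 : ℝ) / 2)))
    linarith

end DVTransfer

/-! ## Registered anchor of this support file -/

/-- ANCHOR (registered helper stub `bhDVTransfer_cellLaw_anchor` of the crux item): floor and ceiling of the
regularised cell law — for a nonnegative kernel family, `h ≠ 0`, `0 ≤ δ ≤ 1`:
`δ M_{1, θ̄+h², ū}(v) ≤ cellLaw(v) ≤ G_h(0) = (2πh²)^{-3/2}`. -/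
theorem bhDVTransfer_cellLaw_anchor : ∀ (ψ : ℕ → T3 → ℝ), (∀ N y, 0 ≤ ψ N y) → ∀ (h : ℝ), h ≠ 0 → ∀ (δ : ℝ), 0 ≤ δ → δ ≤ 1 → ∀ (N : ℕ) (w : Cfg N) (x : T3) (v : V3), δ * localMaxwellian 1 (cT N ψ w x + h ^ 2) (cU N ψ w x) v ≤ cellLaw N ψ h δ w x v ∧ cellLaw N ψ h δ w x v ≤ gauss h 0 0 :=
  fun _ hψ _ hh _ hδ0 hδ1 _ w x v =>
    ⟨DVTransfer.floor_le_cellLaw hψ _ hδ1 w x v, DVTransfer.cellLaw_le_gaussMax hψ hh hδ0 hδ1 w x v⟩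

end

end Summit.AtomisticToContinuum.HydrodynamicLimit.Theorems.BlockHDissipation
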